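import Summits.Ventures.Crystal3D.Theorems.StickyWulffConstantTextureLiminfTexShadowDozenCircumradius
import HarnessLib

/-!
# Twin planes propagate along saturated in-plane neighbours (rigidity step T1 of the terrace-census assembly; memo BETA-ASSEMBLY-g18 §4)

HONEST FRAMING. Venture `Summits/Ventures/Crystal3D` (cell `crystal3d-full`), helper `--supports` the law-v5 crux `TextureLiminfV5`
(stmt-Ventures-23912), lane T, line `TexShadow`, registered stub `stub_terraceCensus` (mechanism (β)).  Finite geometry of the two kissing
patterns (`fccKissingPattern`, `hcpKissingPattern`, Literature) and of `IsClosePackedDozenAt`; nothing about energies; F-C1 not moved.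

THE POINT (memo BETA-ASSEMBLY-g18 §1/§4, lemma T1).  The (β) assembly propagates lattice labels BALL BY BALL through the saturated material of a
filling.  The step that makes a coherent twin plane a RIGID TERRACE: if `c` carries an hcp-type (mirror) dozen and its in-plane neighbour `c'` is
also twelve-fold with a close-packed dozen, then `c'`'s dozen is hcp-type with THE SAME mirror plane.  Mechanism: among the four common neighbours of
`c` and `c'` there is an ECLIPSED pair — an upper ball and its mirror image — which subtend `cos = −1/3` at `c'`; no two members of an fcc dozen do
(`inner_ne_neg_third_of_fccKissingPattern`: in cuboctahedron coordinates all inner products are halves of integers), and in an hcp dozen the pairs at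
`−1/3` are exactly the three mirror pairs, whose difference is the fixed axis vector `(4,4,4)/√18` (`sub_eq_axis_of_hcpKissingPattern`).
* `inner_ne_neg_third_of_fccKissingPattern`, `sub_eq_axis_of_hcpKissingPattern` — the two pattern facts (integer arithmetic);
* `hcpAxis A := A (intVec (4,4,4))/√18 … ` — we use the raw vector `A (intVec ![4,4,4])` (length `4√3`), normal to the mirror plane of the dozen `A·hcp + c`;
* **`exists_hcp_of_inner_eq_neg_third`** — a close-packed dozen around `c` with two members at `⟪d₁ − c, d₂ − c⟫ = −1/3` is hcp-type, with axis
  `∥ d₁ − d₂`;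
* `hcpHex_adjacent_mirrorPair` — every in-plane vector `p₀` of the hcp pattern is adjacent (distance 1) to an upper vector and to its mirror image;
* **`twinPlane_propagates`** — the T1 step: `D = A·hcp + c`, `c' = A p₀ + c` in-plane, `D'` a close-packed dozen around `c'` containing the two
  eclipsed common neighbours ⇒ `D'` is hcp-type with axis `± A (4,4,4)`.
WHAT THIS IS NOT: the fcc-type propagation steps (T2), any statement about configurations beyond the two dozens; F-C1 not moved.
-/

noncomputable section

namespace Summit.Ventures.Crystal3D.Theorems

open Finset Literature.Geometry.DiscreteGeometry
open scoped RealInnerProductSpace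

/-- The inner product of two integer vectors, in coordinates. -/
private theorem inner_intVec_intVec (v w : Fin 3 → ℤ) :
    ⟪intVec v, intVec w⟫ = ((v 0 * w 0 + v 1 * w 1 + v 2 * w 2 : ℤ) : ℝ) := by
  simp [intVec, PiLp.inner_apply, Fin.sum_univ_three, mul_comm]

/-! ## The two pattern facts -/

/-- **No two members of the fcc dozen subtend `cos = −1/3`:** in cuboctahedron coordinates `⟪p, q⟫ = (v·w)/2` with `v·w ∈ ℤ`. -/
theorem inner_ne_neg_third_of_fccKissingPattern {p q : EuclideanSpace ℝ (Fin 3)} (hp : p ∈ fccKissingPattern)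
    (hq : q ∈ fccKissingPattern) : ⟪p, q⟫ ≠ -1 / 3 := by
  obtain ⟨v, -, rfl⟩ := Finset.mem_image.1 hp
  obtain ⟨w, -, rfl⟩ := Finset.mem_image.1 hq
  rw [real_inner_smul_left, real_inner_smul_right, inner_intVec_intVec]
  have hs0 : (0 : ℝ) < Real.sqrt (2 : ℕ) := by positivity
  have hs2 : Real.sqrt (2 : ℕ) ^ 2 = 2 := Real.sq_sqrt (by norm_num)
  intro h
  set k : ℤ := v 0 * w 0 + v 1 * w 1 + v 2 * w 2 with hk
  have h2 : (k : ℝ) = -1 / 3 * Real.sqrt (2 : ℕ) ^ 2 := by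
    field_simp at h
    have : (k : ℝ) = -1 / 3 * (Real.sqrt (2 : ℕ) * Real.sqrt (2 : ℕ)) := by
      field_simp; linarith
    rw [this]; ring
  rw [hs2] at h2
  have h3 : (3 * k : ℤ) = -2 := by
    have : ((3 * k : ℤ) : ℝ) = -2 := by push_cast; linarith
    exact_mod_cast this
  omega

/-- **In the hcp dozen the pairs at `cos = −1/3` are the three mirror pairs**, whose difference is the axis vector `(4,4,4)/√18` (up to sign). -/
theorem sub_eq_axis_of_hcpKissingPattern {p q : EuclideanSpace ℝ (Fin 3)} (hp : p ∈ hcpKissingPattern)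
    (hq : q ∈ hcpKissingPattern) (h : ⟪p, q⟫ = -1 / 3) :
    p - q = (Real.sqrt (18 : ℕ))⁻¹ • intVec ![4, 4, 4] ∨ q - p = (Real.sqrt (18 : ℕ))⁻¹ • intVec ![4, 4, 4] := by
  obtain ⟨v, hv, rfl⟩ := Finset.mem_image.1 hp
  obtain ⟨w, hw, rfl⟩ := Finset.mem_image.1 hq
  rw [real_inner_smul_left, real_inner_smul_right, inner_intVec_intVec] at h
  have hs0 : (0 : ℝ) < Real.sqrt (18 : ℕ) := by positivity
  have hs2 : Real.sqrt (18 : ℕ) ^ 2 = 18 := Real.sq_sqrt (by norm_num)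
  set k : ℤ := v 0 * w 0 + v 1 * w 1 + v 2 * w 2 with hk
  have hk6 : k = -6 := by
    have h2 : (k : ℝ) = -1 / 3 * (Real.sqrt (18 : ℕ) * Real.sqrt (18 : ℕ)) := by
      field_simp at h; field_simp; linarith
    rw [← sq, hs2] at h2
    have : (k : ℝ) = -6 := by rw [h2]; norm_num
    exact_mod_cast this
  -- enumerate: the pairs with `v·w = −6` are the mirror pairs, difference `±(4,4,4)`
  have key : ∀ v ∈ hcpInt, ∀ w ∈ hcpInt, v 0 * w 0 + v 1 * w 1 + v 2 * w 2 = -6 →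
      v - w = ![4, 4, 4] ∨ w - v = ![4, 4, 4] := by decide
  rcases key v hv w hw (by rw [← hk]; exact hk6) with e | e
  · left; rw [← smul_sub, intVec_sub, e]
  · right; rw [← smul_sub, intVec_sub, e]

/-! ## A dozen with an eclipsed pair is hcp-type, axis along the pair's difference -/

/-- **A close-packed dozen containing two members at `cos = −1/3` from the centre is hcp-type**, presented by an isometry `A` whose axis vector
`A (4,4,4)/√18` is `± (d₁ − d₂)`. -/
theorem exists_hcp_of_inner_eq_neg_third {c : EuclideanSpace ℝ (Fin 3)} {D : Finset (EuclideanSpace ℝ (Fin 3))}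
    (hD : IsClosePackedDozenAt c D) {d₁ d₂ : EuclideanSpace ℝ (Fin 3)} (h₁ : d₁ ∈ D) (h₂ : d₂ ∈ D)
    (h : ⟪d₁ - c, d₂ - c⟫ = -1 / 3) :
    ∃ A : EuclideanSpace ℝ (Fin 3) →ₗᵢ[ℝ] EuclideanSpace ℝ (Fin 3),
      (↑D : Set (EuclideanSpace ℝ (Fin 3))) = (fun p => A p + c) '' (↑hcpKissingPattern : Set (EuclideanSpace ℝ (Fin 3))) ∧
      (d₁ - d₂ = (Real.sqrt (18 : ℕ))⁻¹ • A (intVec ![4, 4, 4]) ∨ d₂ - d₁ = (Real.sqrt (18 : ℕ))⁻¹ • A (intVec ![4, 4, 4])) := by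
  obtain ⟨A, hA | hA⟩ := hD
  · -- fcc: impossible
    exfalso
    have h₁' : d₁ ∈ (fun p => A p + c) '' (↑fccKissingPattern : Set _) := by rw [← hA]; exact Finset.mem_coe.2 h₁
    have h₂' : d₂ ∈ (fun p => A p + c) '' (↑fccKissingPattern : Set _) := by rw [← hA]; exact Finset.mem_coe.2 h₂
    obtain ⟨p, hp, rfl⟩ := h₁'
    obtain ⟨q, hq, rfl⟩ := h₂'
    simp only [add_sub_cancel_right, LinearIsometry.inner_map_map] at h
    exact inner_ne_neg_third_of_fccKissingPattern (Finset.mem_coe.1 hp) (Finset.mem_coe.1 hq) h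
  · refine ⟨A, hA, ?_⟩
    have h₁' : d₁ ∈ (fun p => A p + c) '' (↑hcpKissingPattern : Set _) := by rw [← hA]; exact Finset.mem_coe.2 h₁
    have h₂' : d₂ ∈ (fun p => A p + c) '' (↑hcpKissingPattern : Set _) := by rw [← hA]; exact Finset.mem_coe.2 h₂
    obtain ⟨p, hp, rfl⟩ := h₁'
    obtain ⟨q, hq, rfl⟩ := h₂'
    simp only [add_sub_cancel_right, LinearIsometry.inner_map_map] at h
    simp only [add_sub_add_right_eq_sub]
    rcases sub_eq_axis_of_hcpKissingPattern (Finset.mem_coe.1 hp) (Finset.mem_coe.1 hq) h with e | e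
    · left; rw [← map_sub, e, LinearIsometry.map_smul]
    · right; rw [← map_sub, e, LinearIsometry.map_smul]

/-! ## The in-plane step -/

/-- The six IN-PLANE vectors of the hcp integer model (the hexagonal layer `x + y + z = 0`). -/
def hcpHexInt : Finset (Fin 3 → ℤ) :=
  {![3, -3, 0], ![-3, 3, 0], ![3, 0, -3], ![-3, 0, 3], ![0, 3, -3], ![0, -3, 3]}

/-- The hexagon is part of the pattern. -/
theorem hcpHexInt_subset : hcpHexInt ⊆ hcpInt := by decide

/-- **Every in-plane vector `p₀` of the hcp pattern is adjacent to an ECLIPSED PAIR**: an upper vector `u` and its mirror image `l = u − (4,4,4)`, both at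
squared distance `18` (i.e. distance `1` after scaling) from `p₀`. -/
theorem hcpHex_adjacent_mirrorPair : ∀ p₀ ∈ hcpHexInt, ∃ u ∈ hcpInt, ∃ l ∈ hcpInt,
    sqNormInt (u - p₀) = 18 ∧ sqNormInt (l - p₀) = 18 ∧ u - l = ![4, 4, 4] := by decide

/-- Distance between two scaled pattern points from the integer model. -/
private theorem dist_scaled_eq_one {v w : Fin 3 → ℤ} (h : sqNormInt (v - w) = 18) :
    dist ((Real.sqrt (18 : ℕ))⁻¹ • intVec v) ((Real.sqrt (18 : ℕ))⁻¹ • intVec w : EuclideanSpace ℝ (Fin 3)) = 1 := by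
  have hs0 : (0 : ℝ) < Real.sqrt (18 : ℕ) := by positivity
  rw [dist_eq_norm, ← smul_sub, intVec_sub, norm_smul, norm_inv, Real.norm_of_nonneg hs0.le, norm_intVec, h]
  push_cast
  exact inv_mul_cancel₀ (by positivity)

/-- **THE TWIN PLANE PROPAGATES (T1).**  Let `D = A·hcp + c` be an hcp dozen around `c`, `c' = A p₀ + c` one of its six in-plane members, and `D'` a
close-packed dozen around `c'` which contains every ball of `D` at distance `1` from `c'` (e.g. `D'` = all contacts of `c'` in a configuration
containing `D`).  Then `D'` is hcp-type and its axis vector is `± A (4,4,4)`: the same mirror plane. -/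
theorem twinPlane_propagates {c c' : EuclideanSpace ℝ (Fin 3)} {D D' : Finset (EuclideanSpace ℝ (Fin 3))}
    (A : EuclideanSpace ℝ (Fin 3) →ₗᵢ[ℝ] EuclideanSpace ℝ (Fin 3))
    (hA : (↑D : Set (EuclideanSpace ℝ (Fin 3))) = (fun p => A p + c) '' (↑hcpKissingPattern : Set (EuclideanSpace ℝ (Fin 3))))
    {p₀ : Fin 3 → ℤ} (hp₀ : p₀ ∈ hcpHexInt) (hc' : c' = A ((Real.sqrt (18 : ℕ))⁻¹ • intVec p₀) + c)
    (hD' : IsClosePackedDozenAt c' D') (hsub : ∀ d ∈ D, dist c' d = 1 → d ∈ D') :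
    ∃ A' : EuclideanSpace ℝ (Fin 3) →ₗᵢ[ℝ] EuclideanSpace ℝ (Fin 3),
      (↑D' : Set (EuclideanSpace ℝ (Fin 3))) = (fun p => A' p + c') '' (↑hcpKissingPattern : Set (EuclideanSpace ℝ (Fin 3))) ∧
      (A' (intVec ![4, 4, 4]) = A (intVec ![4, 4, 4]) ∨ A' (intVec ![4, 4, 4]) = -A (intVec ![4, 4, 4])) := by
  obtain ⟨u, hu, l, hl, hdu, hdl, hul⟩ := hcpHex_adjacent_mirrorPair p₀ hp₀
  have hs0 : (0 : ℝ) < Real.sqrt (18 : ℕ) := by positivity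
  -- the two eclipsed common neighbours
  set d₁ : EuclideanSpace ℝ (Fin 3) := A ((Real.sqrt (18 : ℕ))⁻¹ • intVec u) + c with hd₁
  set d₂ : EuclideanSpace ℝ (Fin 3) := A ((Real.sqrt (18 : ℕ))⁻¹ • intVec l) + c with hd₂
  have hmem : ∀ {v : Fin 3 → ℤ}, v ∈ hcpInt → A ((Real.sqrt (18 : ℕ))⁻¹ • intVec v) + c ∈ D := fun {v} hv => by
    rw [← Finset.mem_coe, hA]; exact ⟨_, Finset.mem_coe.2 (Finset.mem_image_of_mem _ hv), rfl⟩
  have hdist : ∀ {v : Fin 3 → ℤ}, sqNormInt (v - p₀) = 18 → dist c' (A ((Real.sqrt (18 : ℕ))⁻¹ • intVec v) + c) = 1 := by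
    intro v hv
    rw [hc', dist_eq_norm, add_sub_add_right_eq_sub, ← map_sub, LinearIsometry.norm_map, ← dist_eq_norm, dist_comm]
    exact dist_scaled_eq_one hv
  have h₁ : d₁ ∈ D' := hsub _ (hmem hu) (hdist hdu)
  have h₂ : d₂ ∈ D' := hsub _ (hmem hl) (hdist hdl)
  -- they subtend `−1/3` at `c'`
  have hinner : ⟪d₁ - c', d₂ - c'⟫ = -1 / 3 := by
    have e₁ : d₁ - c' = A ((Real.sqrt (18 : ℕ))⁻¹ • intVec (u - p₀)) := by
      rw [hd₁, hc', add_sub_add_right_eq_sub, ← map_sub, ← smul_sub, intVec_sub]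
    have e₂ : d₂ - c' = A ((Real.sqrt (18 : ℕ))⁻¹ • intVec (l - p₀)) := by
      rw [hd₂, hc', add_sub_add_right_eq_sub, ← map_sub, ← smul_sub, intVec_sub]
    rw [e₁, e₂, LinearIsometry.inner_map_map, real_inner_smul_left, real_inner_smul_right, inner_intVec_intVec]
    have key : ∀ p₀ ∈ hcpHexInt, ∀ u ∈ hcpInt, ∀ l ∈ hcpInt, sqNormInt (u - p₀) = 18 → sqNormInt (l - p₀) = 18 → u - l = ![4, 4, 4] →
        (u - p₀) 0 * (l - p₀) 0 + (u - p₀) 1 * (l - p₀) 1 + (u - p₀) 2 * (l - p₀) 2 = -6 := by decide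
    rw [key p₀ hp₀ u hu l hl hdu hdl hul]
    push_cast
    have hs2 : Real.sqrt 18 ^ 2 = 18 := Real.sq_sqrt (by norm_num)
    field_simp
    rw [hs2]; norm_num
  obtain ⟨A', hA', hax⟩ := exists_hcp_of_inner_eq_neg_third hD' h₁ h₂ hinner
  refine ⟨A', hA', ?_⟩
  have hdiff : d₁ - d₂ = (Real.sqrt (18 : ℕ))⁻¹ • A (intVec ![4, 4, 4]) := by
    rw [hd₁, hd₂, add_sub_add_right_eq_sub, ← map_sub, ← smul_sub, intVec_sub, hul, LinearIsometry.map_smul]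
  have hinv : (Real.sqrt (18 : ℕ))⁻¹ ≠ 0 := inv_ne_zero hs0.ne'
  rcases hax with e | e
  · left
    rw [hdiff] at e
    exact (smul_right_injective _ hinv e).symm
  · right
    rw [← neg_sub, hdiff, ← smul_neg] at e
    exact (smul_right_injective _ hinv e).symm

end Summit.Ventures.Crystal3D.Theorems

end
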